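import Summits.Ventures.YMGap.Thresholds.CouplingSignFlip
import Summits.Ventures.YMGap.Thresholds.StarLimitMassive
import Summits.Ventures.YMGap.Thresholds.StarInfiniteVolume
import HarnessLib

/-!
# Venture YMGap — the coupling-sign symmetry `β ↔ -β` of `SU(2)` lattice Yang–Mills on `ℤ^d`, part 3:
# massive states transport along the flip; every DLR state of `SU(2)` (`d = 4`) is massive at every
# Wilson `|β_W| ≤ 9/25`, two-sided

HONEST FRAMING: venture file (cell `pub-ymgap`, track (c) «DS», red-team brick of ds-3), strong-coupling
LATTICE bookkeeping for `SU(2)` lattice Yang–Mills on `ℤ^d` / `ℤ⁴` with the Wilson action (tree coupling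
`b = β_W/2`).  Currencies: `Literature.Barriers.QuantumFields.IsMassiveState μ` (exponential clustering at ONE
rate of all truncated correlations of bounded measurable gauge-invariant local observables; clause (iii) of the
tree's `osterwalder_seiler_strongCoupling`) and `HasExponentialDecay (plaquetteCorrFn (fundamentalRep (Fin 2)) μ)`
(Chatterjee's `f_β`, Montvay–Münster §3.4.5).  Nothing about the continuum, confinement or the Clay mass gap;
no rate beyond `∃ m > 0`; the inputs on the positive side are tree theorems (ds-2's limit-state rows
`StarLimit.su2_isMassiveState_le_9_25` / `su2_hasExponentialDecay_plaquetteCorrFn_le_9_25` at `0 ≤ β_W ≤ 9/25`, ds-1's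
uniqueness `DSWindowZd.su2_hasUniqueGibbsMeasure_le_9_25`), the negative side comes from the staggered centre
flip of `CouplingSignFlip.lean` (ds-3; `isGibbsMeasure_map_flip`, `map_flip_map_flip`).

* `dependsOn_comp_mulLeft`, `measurable_mulLeft`, `isZdGaugeInvariant_comp_mulLeft` — observables composed
  with a linkwise left multiplication by CENTRAL signs keep support, measurability, bounds and gauge invariance;
* `linkSign_sub` — `η(x − v, μ) = η(v, μ)·η(x, μ)` (the Kogut–Susskind count is additive in the base point), so
  a translate of the flip is the flip followed by a GLOBAL centre twist `U(x, μ) ↦ η(v, μ) U(x, μ)`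
  (`configShift_flip`);
* ★ `isMassiveState_map_flip : IsMassiveState μ → IsMassiveState (μ.map flip)` (any measure; same rate, the
  constant is a maximum over the `2^d` twist patterns);
* `su2_isMassiveState_dlr_le_9_25` — EVERY DLR state at `0 ≤ β_W ≤ 9/25` is massive (uniqueness makes it the
  limit state); ★ `su2_isMassiveState_dlr_of_abs_le (h : |β_W| ≤ 9/25)` — TWO-SIDED; the same for
  `HasExponentialDecay (plaquetteCorrFn …)` (`su2_hasExponentialDecay_plaquetteCorrFn_dlr_le_9_25`, `…_of_abs_le`).

References: J. Kogut, L. Susskind, Phys. Rev. D 11 (1975) 395; H.-O. Georgii (2011) §5.1; K. Osterwalder,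
E. Seiler, Ann. Phys. 110 (1978) §4; cell files `LIMIT-STATES.md` (ds-2), `UNIQUENESS-K-SCOPE.md` (ds-3).
-/

noncomputable section

open MeasureTheory ProbabilityTheory Finset Function
open Literature.Probability.LatticeModels
open Literature.MathematicalPhysics.QuantumLattice
open Literature.MathematicalPhysics.QuantumFieldTheory (haarProbability)
open Literature.MathematicalPhysics.QuantumFieldTheory.Tomboulis2007 (SU2 negOne negOne_mul_comm)
open Literature.Barriers.QuantumFields (IsMassiveState)

namespace Summit.Ventures.YMGap.SignFlip

variable {d : ℕ}

/-! ### Linkwise left multiplication by central signs -/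

/-- Linkwise left multiplication `U ↦ (e ↦ c(e) U(e))` by a field of signs `c`. -/
theorem measurable_mulLeft (c : ZdEdge d → SU2) :
    Measurable (fun U : LGConfig d SU2 => fun e => c e * U e) := by
  refine measurable_pi_iff.2 fun e => ?_
  exact (continuous_const.mul continuous_id).measurable.comp (measurable_pi_apply e)

/-- Composition with a linkwise multiplication keeps the support. [folklore] -/
theorem dependsOn_comp_mulLeft {α : Type*} {F : LGConfig d SU2 → α} {S : Set (ZdEdge d)}
    (hF : DependsOn F S) (c : ZdEdge d → SU2) :
    DependsOn (fun U : LGConfig d SU2 => F (fun e => c e * U e)) S :=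
  fun _ _ h => hF fun e he => by simp only [h e he]

/-- Composition with a linkwise multiplication keeps locality. [folklore] -/
theorem isLocalObservable_comp_mulLeft {α : Type*} {F : LGConfig d SU2 → α} (hF : IsLocalObservable F)
    (c : ZdEdge d → SU2) : IsLocalObservable (fun U : LGConfig d SU2 => F (fun e => c e * U e)) := by
  obtain ⟨S, hS⟩ := hF
  exact ⟨S, dependsOn_comp_mulLeft hS c⟩

/-- Composition with a linkwise multiplication by CENTRAL signs `(-𝟙)^{n(e)}` keeps gauge invariance: the signs
commute with the gauge action `U(e) ↦ g(x) U(e) g(x + e_μ)⁻¹`. [folklore] -/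
theorem isZdGaugeInvariant_comp_mulLeft {α : Type*} {F : LGConfig d SU2 → α} (hF : IsZdGaugeInvariant F)
    (n : ZdEdge d → ℤ) : IsZdGaugeInvariant (fun U : LGConfig d SU2 => F (fun e => sgn (n e) * U e)) := by
  intro g U
  have h : (fun e => sgn (n e) * gaugeTransformZd g U e) = gaugeTransformZd g (fun e => sgn (n e) * U e) := by
    funext e
    simp only [gaugeTransformZd, ← mul_assoc, sgn_comm (n e) (g e.1)]
  show F (fun e => sgn (n e) * gaugeTransformZd g U e) = F (fun e => sgn (n e) * U e)
  rw [h, hF]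

/-- The flip is the linkwise multiplication by the link signs. [folklore] -/
theorem flip_eq_mulLeft : (flip (d := d)) = fun U : LGConfig d SU2 => fun e => sgn (ksPhase e) * U e := rfl

/-! ### The flip and translations: a global centre twist -/

/-- The Kogut–Susskind count is additive in the base point: `ks(x − v, μ) = ks(x, μ) − ks(v, μ)`. [folklore] -/
theorem ksPhase_sub (x v : Site d) (μ : Fin d) : ksPhase (x - v, μ) = ksPhase (x, μ) - ksPhase (v, μ) := by
  simp only [ksPhase, Pi.sub_apply, sum_sub_distrib]

/-- `η(x − v, μ) = η(v, μ) · η(x, μ)`. [folklore] -/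
theorem linkSign_sub (x v : Site d) (μ : Fin d) :
    linkSign (x - v, μ) = linkSign (v, μ) * linkSign (x, μ) := by
  unfold linkSign
  have hneg : sgn (-ksPhase (v, μ)) = sgn (ksPhase (v, μ)) := by
    rcases Int.even_or_odd (ksPhase (v, μ)) with h | h
    · rw [sgn_of_even h, sgn_of_even (even_neg.2 h)]
    · rw [sgn_of_odd h, sgn_of_odd (odd_neg.2 h)]
  rw [ksPhase_sub, sub_eq_add_neg, sgn_add, hneg, sgn_comm]

/-- **A translate of the flipped field is the twisted flip of the translate**:
`θ_v(flip U)(x, μ) = η(v, μ) · flip(θ_v U)(x, μ)` — the staggered flip commutes with translations up to the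
GLOBAL centre twist `U(x, μ) ↦ η(v, μ) U(x, μ)`. [folklore] -/
theorem configShift_flip (v : Site d) (U : LGConfig d SU2) :
    configShift v (flip U) = fun e => linkSign (v, e.2) * flip (configShift v U) e := by
  funext e
  rw [Literature.MathematicalPhysics.QuantumLattice.configShift_apply, flip_apply, flip_apply,
    Literature.MathematicalPhysics.QuantumLattice.configShift_apply, linkSign_sub, mul_assoc]

/-! ### Massive states transport along the flip -/

/-- ★ **The image of a massive state under the flip is massive** (same rate).  For gauge-invariant bounded
measurable local `F₁, F₂`: `cov_{μ∘flip⁻¹}(F₁, F₂∘θ_x) = cov_μ(F₁∘flip, (F₂∘θ_x)∘flip)` and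
`(F₂∘θ_x)∘flip = (F₂∘τ_x∘flip)∘θ_x` with the global twist `τ_x` (`configShift_flip`), which runs over at most
`2^d` sign patterns; `F₁∘flip` and `F₂∘τ∘flip` are again gauge-invariant bounded measurable local observables
(central signs), so `IsMassiveState μ` bounds each pattern and the maximum of the constants serves all `x`.
[folklore] -/
theorem isMassiveState_map_flip {μ : Measure (LGConfig 4 SU2)} (h : IsMassiveState μ) :
    IsMassiveState (μ.map flip) := by
  classical
  obtain ⟨m, hm⟩ := h
  refine ⟨m, fun F₁ F₂ h₁ h₂ h₁m h₂m hb₁ hb₂ hg₁ hg₂ => ?_⟩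
  -- the sign pattern of a displacement and the twisted-flipped second observable
  let pat : Site 4 → (Fin 4 → Bool) := fun x μ => decide (Even (ksPhase (x, μ)))
  let nS : (Fin 4 → Bool) → ZdEdge 4 → ℤ := fun s e => (if s e.2 then 0 else 1) + ksPhase e
  let G : (Fin 4 → Bool) → LGConfig 4 SU2 → ℝ := fun s U => F₂ (fun e => sgn (nS s e) * U e)
  let F₁' : LGConfig 4 SU2 → ℝ := fun U => F₁ (fun e => sgn (ksPhase e) * U e)
  -- the observables fed to `IsMassiveState μ`
  have hF₁'loc : IsLocalObservable F₁' := isLocalObservable_comp_mulLeft h₁ _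
  have hF₁'m : Measurable F₁' := h₁m.comp (measurable_mulLeft _)
  have hF₁'b : ∃ C, ∀ U, |F₁' U| ≤ C := by obtain ⟨C, hC⟩ := hb₁; exact ⟨C, fun U => hC _⟩
  have hF₁'g : IsZdGaugeInvariant F₁' := isZdGaugeInvariant_comp_mulLeft hg₁ _
  have hGloc : ∀ s, IsLocalObservable (G s) := fun s => isLocalObservable_comp_mulLeft h₂ _
  have hGm : ∀ s, Measurable (G s) := fun s => h₂m.comp (measurable_mulLeft _)
  have hGb : ∀ s, ∃ C, ∀ U, |G s U| ≤ C := fun s => by obtain ⟨C, hC⟩ := hb₂; exact ⟨C, fun U => hC _⟩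
  have hGg : ∀ s, IsZdGaugeInvariant (G s) := fun s => isZdGaugeInvariant_comp_mulLeft hg₂ _
  have key : ∀ s, ∃ C : ℝ, ∀ y : Site 4,
      |cov[F₁', fun U => G s (configShift y U); μ]| ≤ C * Real.exp (-m * ‖y‖) :=
    fun s => (hm F₁' (G s) hF₁'loc (hGloc s) hF₁'m (hGm s) hF₁'b (hGb s) hF₁'g (hGg s)).2
  choose Cf hCf using key
  have hm0 : 0 < m :=
    (hm F₁' (G (pat 0)) hF₁'loc (hGloc _) hF₁'m (hGm _) hF₁'b (hGb _) hF₁'g (hGg _)).1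
  refine ⟨hm0, ∑ s, |Cf s|, fun x => ?_⟩
  -- `η(x, μ) = (-𝟙)^{[pattern]}`: the twist of `configShift_flip` in the `sgn ∘ nS (pat x)` form
  have hsgn : ∀ e : ZdEdge 4, linkSign (x, e.2) * linkSign e = sgn (nS (pat x) e) := by
    intro e
    have h1 : sgn (ksPhase (x, e.2)) = sgn (if pat x e.2 then 0 else 1) := by
      by_cases he : Even (ksPhase (x, e.2))
      · have hp : pat x e.2 = true := decide_eq_true he
        rw [hp, if_pos rfl, sgn_of_even he, sgn_of_even (Even.zero : Even (0 : ℤ))]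
      · have hp : pat x e.2 = false := decide_eq_false he
        rw [hp, sgn_of_odd (Int.not_even_iff_odd.1 he)]
        simp only [Bool.false_eq_true, ↓reduceIte]
        rw [sgn_of_odd odd_one]
    show sgn (ksPhase (x, e.2)) * sgn (ksPhase e) = sgn ((if pat x e.2 then 0 else 1) + ksPhase e)
    rw [sgn_add, h1]
  have hobs : (fun U => F₂ (configShift x U)) ∘ flip = fun U => G (pat x) (configShift x U) := by
    funext U
    simp only [Function.comp_apply, G]
    rw [configShift_flip]
    congr 1
    funext e
    rw [flip_apply, ← mul_assoc, hsgn, Literature.MathematicalPhysics.QuantumLattice.configShift_apply]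
  have hcov : cov[F₁, fun U => F₂ (configShift x U); μ.map flip] =
      cov[F₁', fun U => G (pat x) (configShift x U); μ] := by
    rw [← coe_flipEquiv, covariance_map_equiv, coe_flipEquiv, hobs]
    rfl
  dsimp only
  rw [hcov]
  refine (hCf (pat x) x).trans (mul_le_mul_of_nonneg_right ?_ (Real.exp_pos _).le)
  exact (le_abs_self _).trans (Finset.single_le_sum (fun s _ => abs_nonneg (Cf s)) (Finset.mem_univ (pat x)))

/-- Iff form: the flip is an involution on measures. [folklore] -/
theorem isMassiveState_map_flip_iff (μ : Measure (LGConfig 4 SU2)) :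
    IsMassiveState (μ.map flip) ↔ IsMassiveState μ :=
  ⟨fun h => by simpa only [map_flip_map_flip] using isMassiveState_map_flip h, isMassiveState_map_flip⟩

/-! ### `SU(2)`, `d = 4`: every DLR state is massive at every Wilson `|β_W| ≤ 9/25` -/

/-- **Every DLR state of `SU(2)` lattice Yang–Mills on `ℤ⁴` at `0 ≤ β_W ≤ 9/25` is massive** (NO hypothesis):
the DLR state at tree coupling `β_W/2` is unique (ds-1's `DSWindowZd.su2_hasUniqueGibbsMeasure_le_9_25`), hence
equal to the infinite-volume limit point, which is massive by ds-2's `StarLimit.su2_isMassiveState_le_9_25`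
(quarter modulus + Lemma G; rate `κ(R_G(9/25))`). [folklore] -/
theorem su2_isMassiveState_dlr_le_9_25 {βW : ℝ} (h0 : 0 ≤ βW) (h : βW ≤ 9 / 25) :
    ∀ μ ∈ ymGibbsMeasures (d := 4) (fundamentalRep (Fin 2)) (βW / 2), IsMassiveState μ := by
  intro μ hμ
  haveI : SecondCountableTopology (Matrix (Fin 2) (Fin 2) ℂ) :=
    inferInstanceAs (SecondCountableTopology (Fin 2 → Fin 2 → ℂ))
  haveI : SecondCountableTopology SU2 := Topology.IsEmbedding.subtypeVal.secondCountableTopology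
  have hρc := continuous_fundamentalRep (Fin 2)
  obtain ⟨ν, hν⟩ := infiniteVolumeLimitPoints_nonempty_holds (d := 4) (fundamentalRep (Fin 2)) hρc (βW / 2)
  have hνG : ν ∈ ymGibbsMeasures (d := 4) (fundamentalRep (Fin 2)) (βW / 2) :=
    mem_ymGibbsMeasures_of_mem_infiniteVolumeLimitPoints_holds (d := 4) (fundamentalRep (Fin 2)) hρc hν
  have huniq := DSWindowZd.su2_hasUniqueGibbsMeasure_le_9_25 h0 h
  have e : ((2 : ℕ) : ℝ) * (βW / 4) = βW / 2 := by push_cast; ring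
  rw [e] at huniq
  rw [huniq.1 hμ hνG]
  exact StarLimit.su2_isMassiveState_le_9_25 h0 h ν hν

/-- ★ **TWO-SIDED: every DLR state of `SU(2)` lattice Yang–Mills on `ℤ⁴` is massive at every Wilson
`|β_W| ≤ 9/25`** (NO hypothesis): for `β_W < 0` the flipped state is a DLR state at `−β_W/2 ≥ 0`
(`isGibbsMeasure_map_flip`), massive by the one-sided row, and the flip transports massivity back
(`isMassiveState_map_flip`, `map_flip_map_flip`). [folklore] -/
theorem su2_isMassiveState_dlr_of_abs_le {βW : ℝ} (h : |βW| ≤ 9 / 25) :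
    ∀ μ ∈ ymGibbsMeasures (d := 4) (fundamentalRep (Fin 2)) (βW / 2), IsMassiveState μ := by
  intro μ hμ
  rcases le_or_gt 0 βW with h0 | h0
  · exact su2_isMassiveState_dlr_le_9_25 h0 ((le_abs_self βW).trans h) μ hμ
  · have hμ' : μ.map flip ∈ ymGibbsMeasures (d := 4) (fundamentalRep (Fin 2)) (-βW / 2) := by
      have := isGibbsMeasure_map_flip (d := 4) hμ
      rw [show -(βW / 2) = -βW / 2 by ring] at this
      exact this
    have hm' : IsMassiveState (μ.map flip) :=
      su2_isMassiveState_dlr_le_9_25 (by linarith) (by linarith [neg_le_abs βW]) _ hμ'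
    rw [← map_flip_map_flip μ]
    exact isMassiveState_map_flip hm'

/-- A massive DLR state of `SU(2)` lattice Yang–Mills on `ℤ⁴` has an exponentially decaying plaquette–plaquette
correlation function (the tree's plaquette criterion
`not_exists_clusteringRate_of_not_hasExponentialDecay_plaquetteCorrFn`; DLR states are probability measures).
[folklore] -/
theorem hasExponentialDecay_plaquetteCorrFn_of_isMassiveState_dlr {b : ℝ} {μ : Measure (LGConfig 4 SU2)}
    (hμ : μ ∈ ymGibbsMeasures (d := 4) (fundamentalRep (Fin 2)) b) (hm : IsMassiveState μ) :
    HasExponentialDecay (plaquetteCorrFn (fundamentalRep (Fin 2)) μ) := by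
  haveI : SecondCountableTopology (Matrix (Fin 2) (Fin 2) ℂ) :=
    inferInstanceAs (SecondCountableTopology (Fin 2 → Fin 2 → ℂ))
  haveI : SecondCountableTopology SU2 := Topology.IsEmbedding.subtypeVal.secondCountableTopology
  haveI : IsProbabilityMeasure μ := IsGibbsMeasure.isProbabilityMeasure hμ
  by_contra h
  exact Literature.Barriers.QuantumFields.not_exists_clusteringRate_of_not_hasExponentialDecay_plaquetteCorrFn
    (fundamentalRep (Fin 2)) (continuous_fundamentalRep (Fin 2))
    (fun U => fundamentalRep_mem_unitaryGroup U) h hm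

/-- **Plaquette–plaquette decay for every DLR state of `SU(2)` at `0 ≤ β_W ≤ 9/25`** (NO hypothesis). [folklore] -/
theorem su2_hasExponentialDecay_plaquetteCorrFn_dlr_le_9_25 {βW : ℝ} (h0 : 0 ≤ βW) (h : βW ≤ 9 / 25) :
    ∀ μ ∈ ymGibbsMeasures (d := 4) (fundamentalRep (Fin 2)) (βW / 2),
      HasExponentialDecay (plaquetteCorrFn (fundamentalRep (Fin 2)) μ) :=
  fun μ hμ => hasExponentialDecay_plaquetteCorrFn_of_isMassiveState_dlr hμ
    (su2_isMassiveState_dlr_le_9_25 h0 h μ hμ)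

/-- ★ **TWO-SIDED plaquette–plaquette decay for every DLR state of `SU(2)` lattice Yang–Mills on `ℤ⁴` at every
Wilson `|β_W| ≤ 9/25`** (NO hypothesis). [folklore] -/
theorem su2_hasExponentialDecay_plaquetteCorrFn_dlr_of_abs_le {βW : ℝ} (h : |βW| ≤ 9 / 25) :
    ∀ μ ∈ ymGibbsMeasures (d := 4) (fundamentalRep (Fin 2)) (βW / 2),
      HasExponentialDecay (plaquetteCorrFn (fundamentalRep (Fin 2)) μ) :=
  fun μ hμ => hasExponentialDecay_plaquetteCorrFn_of_isMassiveState_dlr hμ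
    (su2_isMassiveState_dlr_of_abs_le h μ hμ)

end Summit.Ventures.YMGap.SignFlip

end
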